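import Mathlib
import HarnessLib
import Summits.Langlands.Langlands.Theses.ExteriorSquareAscent
import Literature.NumberTheory.Automorphic.HLTTCompatible
import Literature.NumberTheory.GaloisRepresentations.ResidualGaloisRep
import Literature.NumberTheory.GaloisRepresentations.HeckeCharacter
import Literature.NumberTheory.LFunctions.ChebotarevDensity

/-!
# Sketch — crux-ideate stmt-Langlands-18056 (`RestOfReciprocity`), round 1, ideator k = 1

First checkable statements ("First lemma") of the two crux idea cards, typed over existing
declarations.  Nothing here is proved; every `def … : Prop` must elaborate.

* Card `level-nonlowering-from-x` (§1): `RamificationVisibleDensityOne` — X ⇒ at a density-one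
  set of primes `ℓ`, the semisimple HLTT-compatible avatars of a weight-0 sector `π` on `GL₄` over a
  totally real / CM field see every ramified place of `π` (Luu–Allen–Newton level-lowering
  contradiction, rank 4); plus the residual input `ResiduallyIrreducibleDensityOne`.
* Card `de-rham-replaces-hecke-field` (§2): `HeckeCharacterOfDeRham` — a de Rham (pinned datum)
  `ℓ`-adic character of `Γ_K` comes from an algebraic Hecke character (Tate–Sen–Serre; = the weak
  form of clause (B) for `n = 1`), and `IrreducibleGL4Geometric` — the rank-4 irreducibility that
  `RestOfReciprocity` actually consumes: NO Hecke field, NO C-algebraicity, ρ GEOMETRIC.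
-/

open scoped NumberField Polynomial Classical
open NumberField IsDedekindDomain Filter Polynomial
open Literature.NumberTheory.Automorphic Literature.NumberTheory.GaloisRepresentations
open Summit.Langlands.Langlands.Theses.ExteriorSquareAscent

noncomputable section

namespace Summit.Langlands.Langlands.Cruxes.RestOfReciprocity.IdeateR1K1

/-! ## §0  The sector clauses of X, named (verbatim sub-terms of `IrreducibleGL4`) -/

/-- π has a Hecke field at Satake level (X's second hypothesis, verbatim). -/
def HasHeckeField {K : Type} [Field K] [NumberField K]
    {hcpt : isCompact_glFiniteIntegralLevel 4 K} (π : CuspidalAutomorphicRepData 4 K hcpt) : Prop :=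
  ∃ E : Subfield ℂ, FiniteDimensional ℚ E ∧ ∀ᶠ v in cofinite, ∀ α : Multiset ℂ,
    π.1.HasSatakeParamAt v α → ∀ i ≤ 4,
      ((((Real.sqrt (v.residueCard : ℝ)) : ℝ) : ℂ) ^ (i * (4 - i))) * α.esymm i ∈ E

/-- π is essentially self-dual at Satake level (X's excluded locus, verbatim). -/
def IsEssSelfDualSatake {K : Type} [Field K] [NumberField K]
    (h1 : isCompact_glFiniteIntegralLevel 1 K) {hcpt : isCompact_glFiniteIntegralLevel 4 K}
    (π : CuspidalAutomorphicRepData 4 K hcpt) : Prop :=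
  ∃ η : CuspidalAutomorphicRepData 1 K h1, ∀ᶠ v in cofinite, ∀ α : Multiset ℂ,
    π.1.HasSatakeParamAt v α → ∃ e : ℂ, η.1.HasSatakeParamAt v {e} ∧
      α.map (fun a => a⁻¹) = α.map (fun a => e * a)

/-- π is self-twisted by the quadratic sign of some quadratic `L'/K` at Satake level (verbatim the
case-split clause of `closes`). -/
def IsQuadSelfTwisted {K : Type} [Field K] [NumberField K]
    {hcpt : isCompact_glFiniteIntegralLevel 4 K} (π : CuspidalAutomorphicRepData 4 K hcpt) : Prop :=
  ∃ (L' : Type) (_ : Field L') (_ : NumberField L') (_ : Algebra K L'), Module.finrank K L' = 2 ∧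
    ∀ᶠ v : HeightOneSpectrum (𝓞 K) in cofinite, ∀ α : Multiset ℂ, π.1.HasSatakeParamAt v α →
      α.map (fun a => (if ∃ w : HeightOneSpectrum (𝓞 L'),
        w.asIdeal.under (𝓞 K) = v.asIdeal ∧ w.asIdeal.inertiaDeg (𝓞 K) = 1 then (1 : ℂ) else -1) * a) = α

/-- C-normalised Satake–Frobenius compatibility a.e. (verbatim X's compatibility clause; the
convention of lang.S27 / HLTT, `arithFrobPolyOfSatake ι q 4`). -/
def CompatibleAE {K : Type} [Field K] [NumberField K] {hcpt : isCompact_glFiniteIntegralLevel 4 K}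
    (π : CuspidalAutomorphicRepData 4 K hcpt) {ℓ : ℕ} [Fact ℓ.Prime] (ι : PadicAlgCl ℓ ≃+* ℂ)
    (ρ : FramedGaloisRep K (PadicAlgCl ℓ) 4) : Prop :=
  ∀ᶠ v : HeightOneSpectrum (𝓞 K) in cofinite, ∃ α : Multiset ℂ, π.1.HasSatakeParamAt v α ∧
    ρ.IsUnramifiedAt v ∧ ρ.HasFrobCharpolyAt v (arithFrobPolyOfSatake ι v.residueCard 4 α)

/-- Sanity: X is literally the sector statement over these named clauses. -/
example : IrreducibleGL4 ↔
    ∀ (K : Type) [Field K] [NumberField K] (h1 : isCompact_glFiniteIntegralLevel 1 K)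
      (hcpt : isCompact_glFiniteIntegralLevel 4 K) (π : CuspidalAutomorphicRepData 4 K hcpt),
      π.1.IsCAlgebraic → HasHeckeField π → ¬ IsEssSelfDualSatake h1 π →
      ∀ (ℓ : ℕ) [Fact ℓ.Prime] (ι : PadicAlgCl ℓ ≃+* ℂ) (ρ : FramedGaloisRep K (PadicAlgCl ℓ) 4),
        ρ.toGaloisRep.IsSemisimple → CompatibleAE π ι ρ → ρ.toGaloisRep.IsIrreducible :=
  Iff.rfl

/-- `ρ` is **potentially abelian**: abelian on the absolute Galois group of some finite extension
(for an irreducible Hodge–Tate-regular `ρ` this is the monomial case `ρ ≅ Ind_{L}^{K} χ`,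
Calegari–Gee / Patrikis; it is the escape clause of card 1: such `ρ` have virtually abelian, never
enormous, residual images). -/
def PotAbelian {K : Type} [Field K] [NumberField K] {ℓ : ℕ} [Fact ℓ.Prime] {n : ℕ}
    (ρ : FramedGaloisRep K (PadicAlgCl ℓ) n) : Prop :=
  ∃ (L : Type) (_ : Field L) (_ : NumberField L) (_ : Algebra K L),
    ∀ g h : Field.absoluteGaloisGroup L,
      (ρ.restrictField L : Field.absoluteGaloisGroup L →* GL (Fin n) (PadicAlgCl ℓ)) g *
        (ρ.restrictField L : Field.absoluteGaloisGroup L →* GL (Fin n) (PadicAlgCl ℓ)) h =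
      (ρ.restrictField L : Field.absoluteGaloisGroup L →* GL (Fin n) (PadicAlgCl ℓ)) h *
        (ρ.restrictField L : Field.absoluteGaloisGroup L →* GL (Fin n) (PadicAlgCl ℓ)) g

/-! ## §1  Card `level-nonlowering-from-x` -/

/-- **First lemma of card 1 (residual input).**  X ⇒ for every totally real or CM `K` and every
REGULAR algebraic cuspidal `π` on `GL₄(𝔸_K)` in X's sector (Hecke field — automatic for regular
algebraic π by Clozel, kept verbatim —, not essentially self-dual) there is a set `P` of rational
primes of Dirichlet density one such that for `ℓ ∈ P`, every `ι` and every SEMISIMPLE a.e.-compatible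
`ρ : Γ_K → GL₄(ℚ̄_ℓ)` (= `r_{ℓ,ι}(π)` up to conjugacy) is residually absolutely irreducible.
Route: X gives absolute irreducibility of the E-rational semisimple compatible system
`{r_{λ}(π)}` at EVERY λ; Patrikis–Snowden–Wiles Thm 2 / Böckle–Hui 2026 give the residual
statement at density one. -/
def ResiduallyIrreducibleDensityOne : Prop :=
  IrreducibleGL4 →
    ∀ (K : Type) [Field K] [NumberField K], IsTotallyReal K ∨ IsCMField K →
    ∀ (h1 : isCompact_glFiniteIntegralLevel 1 K) (hcpt : isCompact_glFiniteIntegralLevel 4 K)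
      (π : CuspidalAutomorphicRepData 4 K hcpt),
      π.1.IsRegularAlgebraic → HasHeckeField π → ¬ IsEssSelfDualSatake h1 π →
      ∃ P : Set ℕ, Literature.NumberTheory.LFunctions.HasDirichletDensity P 1 ∧
        ∀ (ℓ : ℕ) [Fact ℓ.Prime], ℓ ∈ P → ∀ (ι : PadicAlgCl ℓ ≃+* ℂ)
          (ρ : FramedGaloisRep K (PadicAlgCl ℓ) 4),
          ρ.toGaloisRep.IsSemisimple → CompatibleAE π ι ρ → ρ.IsResiduallyAbsIrreducible

/-- **First lemma of card 1 (the deliverable, typed): ramification of `π` is visible in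
`r_{ℓ,ι}(π)` at a density-one set of primes** (Luu–Allen–Newton in rank 4).  X ⇒ for `K` totally
real or CM and `π` cuspidal on `GL₄(𝔸_K)` of WEIGHT ZERO (cohomological, trivial coefficients —
the Fontaine–Laffaille window of ACC+ Thm 6.1.1 and the weight of the Dwork motives), in X's sector
and not quadratically self-twisted (strongly-irreducible regime), there is a density-one set `P` of
primes such that for `ℓ ∈ P`, every `ι`, every semisimple HLTT-compatible `ρ` and every finite
`v ∤ ℓ`: `ρ` unramified at `v` ⇒ `π` unramified at `v` — UNLESS `ρ` is potentially abelian (the monomial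
case `Ind` from a primitive quartic field, invisible at Satake level by self-twists, where residual images
are virtually abelian and no automorphy lifting theorem applies; X + the Calegari–Gee–Patrikis dichotomy
for Hodge–Tate-regular irreducible `ρ` make this the ONLY escape).  With Varma's semisimple compatibility this
is exactly "`N(WD(ρ|_{Γ_{K_v}})) ≠ 0` whenever `rec(π_v)^{ss}` is unramified and `π_v` is not" —
Allen–Newton's Thm 1.1 in rank 4; with Varma's `≺` it gives the full F-ss local–global
compatibility at every `v` whose predicted monodromy has rank ≤ 1. -/
def RamificationVisibleDensityOne : Prop :=
  IrreducibleGL4 →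
    ∀ (K : Type) [Field K] [NumberField K], IsTotallyReal K ∨ IsCMField K →
    ∀ (h1 : isCompact_glFiniteIntegralLevel 1 K) (hcpt : isCompact_glFiniteIntegralLevel 4 K)
      (π : CuspidalAutomorphicRepData 4 K hcpt),
      π.1.HasWeightZero → HasHeckeField π → ¬ IsEssSelfDualSatake h1 π → ¬ IsQuadSelfTwisted π →
      ∃ P : Set ℕ, Literature.NumberTheory.LFunctions.HasDirichletDensity P 1 ∧
        ∀ (ℓ : ℕ) [Fact ℓ.Prime], ℓ ∈ P → ∀ (ι : PadicAlgCl ℓ ≃+* ℂ)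
          (ρ : FramedGaloisRep K (PadicAlgCl ℓ) 4),
          ρ.toGaloisRep.IsSemisimple → HLTT.IsCompatible π.1 ι ρ →
          PotAbelian ρ ∨
            ∀ v : HeightOneSpectrum (𝓞 K), ((ℓ : ℕ) : 𝓞 K) ∉ v.asIdeal →
              ρ.IsUnramifiedAt v → π.1.IsUnramifiedAt v

/-! ## §2  Card `de-rham-replaces-hecke-field` -/

/-- **First lemma of card 2: a de Rham `ℓ`-adic character is the avatar of an algebraic Hecke
character** (Tate–Sen: a Hodge–Tate character of `Γ_{K_v}` is locally algebraic — Serre 1968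
Ch. III Appendix (Tate), Böckle–Hui 2025 Rem. 2.1 "[Se98]: locally algebraic iff Hodge–Tate at
`v ∈ S_ℓ`" —, then Serre Ch. III §2.3 Thm 2, IN TREE as
`exists_heckeCharacter_of_isLocAlgAt`).  De Rham-ness is relative to the PINNED Fontaine datum of
the summit (`fontainePstAdicCompletion`), exactly as in `Summit.Langlands.IsGeometricFramed`; the
conclusion is verbatim that of the named fact `exists_heckeCharacter_of_weaklyDivides` (BH Thm 1.1),
which it REPLACES wherever X's proof consumes the Hecke field.  It is also the weak form
(Satake–Frobenius a.e., through the GL₁ dictionary) of clause (B) of the summit for `n = 1`. -/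
def HeckeCharacterOfDeRham : Prop :=
  ∀ (K : Type) [Field K] [NumberField K] (ℓ : ℕ) [Fact ℓ.Prime]
    (ψ : FramedGaloisRep K (PadicAlgCl ℓ) 1),
    (∀ (v : HeightOneSpectrum (𝓞 K)) (hv : ((ℓ : ℕ) : 𝓞 K) ∈ v.asIdeal),
      (Literature.NumberTheory.PAdicHodge.fontainePstAdicCompletion v ℓ hv).IsDeRhamFramed
        (ψ.toLocal v)) →
    ∀ ι : PadicAlgCl ℓ ≃+* ℂ, ∃ χ : HeckeCharacter K, χ.IsAlgebraic ∧
      ∀ᶠ v : HeightOneSpectrum (𝓞 K) in cofinite, χ.IsUnramifiedAt v ∧ ψ.IsUnramifiedAt v ∧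
        ψ.HasFrobCharpolyAt v (X - C (ι.symm (χ.valueAtUniformizer v)⁻¹))

/-- **The transferred rank-4 statement `X_geo` (card 2's C⁺ for the rank-4 irreducibility that
`RestOfReciprocity` consumes).**  Any number field `K`; `π` cuspidal on `GL₄(𝔸_K)` NOT essentially
self-dual at Satake level; `ρ : Γ_K → GL₄(ℚ̄_ℓ)` semisimple, GEOMETRIC for the pinned datum
(de Rham at every `v ∣ ℓ`; a.e. unramified is inside the compatibility clause) and C-compatible
with `(π, ι)` a.e.  Then `ρ` is irreducible.  NO Hecke-field hypothesis, NO `IsCAlgebraic`: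
every point of X's proof line (cruxes 3, 4 of the route) where they enter is an "abelian
sub-quotient character of `ρ`, `ρ|_L`, `∧²ρ` is an algebraic Hecke character" step, supplied here
by `HeckeCharacterOfDeRham` (sub-quotients, restrictions, exterior powers and determinants of de
Rham representations are de Rham).  Clause (A) of the summit asks irreducibility of a GEOMETRIC
avatar only, so `X_geo` (+ the essentially-self-dual sector) is all of rank 4 that
`RestOfReciprocity` needs. -/
def IrreducibleGL4Geometric : Prop :=
  ∀ (K : Type) [Field K] [NumberField K] (h1 : isCompact_glFiniteIntegralLevel 1 K)
    (hcpt : isCompact_glFiniteIntegralLevel 4 K) (π : CuspidalAutomorphicRepData 4 K hcpt),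
    ¬ IsEssSelfDualSatake h1 π →
    ∀ (ℓ : ℕ) [Fact ℓ.Prime] (ι : PadicAlgCl ℓ ≃+* ℂ) (ρ : FramedGaloisRep K (PadicAlgCl ℓ) 4),
      ρ.toGaloisRep.IsSemisimple →
      (∀ (v : HeightOneSpectrum (𝓞 K)) (hv : ((ℓ : ℕ) : 𝓞 K) ∈ v.asIdeal),
        (Literature.NumberTheory.PAdicHodge.fontainePstAdicCompletion v ℓ hv).IsDeRhamFramed
          (ρ.toLocal v)) →
      CompatibleAE π ι ρ → ρ.toGaloisRep.IsIrreducible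

/-- **What `RestOfReciprocity` needs in rank 4, L-normalised** (the shape inside clause (A): π
L-algebraic, `ρ` the GEOMETRIC semisimple avatar, `arithFrobPolyOfSatake ι q 1`): the target of the
reshaped stub replacing `stub_irreducibleRankFourOfGL4`. -/
def IrreducibleGeometricAvatarRankFour : Prop :=
  ∀ (K : Type) [Field K] [NumberField K] (hcpt : isCompact_glFiniteIntegralLevel 4 K)
    (π : CuspidalAutomorphicRepData 4 K hcpt), π.1.IsLAlgebraic →
    ∀ (ℓ : ℕ) [Fact ℓ.Prime] (ι : PadicAlgCl ℓ ≃+* ℂ) (ρ : FramedGaloisRep K (PadicAlgCl ℓ) 4),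
      ρ.toGaloisRep.IsSemisimple →
      (∀ (v : HeightOneSpectrum (𝓞 K)) (hv : ((ℓ : ℕ) : 𝓞 K) ∈ v.asIdeal),
        (Literature.NumberTheory.PAdicHodge.fontainePstAdicCompletion v ℓ hv).IsDeRhamFramed
          (ρ.toLocal v)) →
      (∀ᶠ v : HeightOneSpectrum (𝓞 K) in cofinite, Summit.Langlands.SatakeFrobCompatibleAt ι π.1 ρ v) →
      ρ.toGaloisRep.IsIrreducible

/-- **The essentially-self-dual remainder in rank 4** (GSp₄ / GO₄ type), geometric avatars only —
the honest open complement of `X_geo` in rank 4 (all-ℓ irreducibility open even over totally real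
`K`; Calegari–Gee 2013 density one, Ramakrishnan 2013, Weissauer). -/
def IrreducibleGL4SelfDualGeometric : Prop :=
  ∀ (K : Type) [Field K] [NumberField K] (h1 : isCompact_glFiniteIntegralLevel 1 K)
    (hcpt : isCompact_glFiniteIntegralLevel 4 K) (π : CuspidalAutomorphicRepData 4 K hcpt),
    IsEssSelfDualSatake h1 π →
    ∀ (ℓ : ℕ) [Fact ℓ.Prime] (ι : PadicAlgCl ℓ ≃+* ℂ) (ρ : FramedGaloisRep K (PadicAlgCl ℓ) 4),
      ρ.toGaloisRep.IsSemisimple →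
      (∀ (v : HeightOneSpectrum (𝓞 K)) (hv : ((ℓ : ℕ) : 𝓞 K) ∈ v.asIdeal),
        (Literature.NumberTheory.PAdicHodge.fontainePstAdicCompletion v ℓ hv).IsDeRhamFramed
          (ρ.toLocal v)) →
      CompatibleAE π ι ρ → ρ.toGaloisRep.IsIrreducible

end Summit.Langlands.Langlands.Cruxes.RestOfReciprocity.IdeateR1K1

end
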